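import Summits.ValiantsHypothesis.ValiantsHypothesis.Theorems.LacunarySymmetroidMatrixDescartesFirstRung

/-!
# Crux `DerivedPencilRolleQuasi` (stmt-ValiantsHypothesis-18064) — the PSD SECTOR (rung (a))

The crux asks for constants `C, A` with
`Z₊(det F) ≤ C · Z₊(det ∂F) + (K+1)^(A·K) · 2^((log₂ m + 2)^A)` for every `(K+1)`-term lacunary
pencil `F = ∑ₗ X^{d l} • S l` with real symmetric invertible `m × m` coefficients and strictly
increasing exponents, where `∂F = ∑_{l ≥ 1} (d l − d 0) X^{d l − d 0 − 1} • S l` and `Z₊` counts the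
distinct positive real roots.

This file settles the **positive semidefinite sector** of the crux — the pencils whose LACUNARY TAIL
`S 1, …, S K` is positive semidefinite (the head `S 0` is an arbitrary real symmetric matrix) — in the
crux's verbatim vocabulary, unconditionally and for ALL constants `C` and all `A ≥ 1`:

* `psdSector_card_posRoots_le` : `Z₊(det F) ≤ m` (Loewner monotonicity of
  `t ↦ t^{-d 0} F(t)` on `(0,∞)`; inertia chain).  This is the tree theorem
  `LacunarySymmetroidMatrixDescartes.firstRung_low` (sibling crux `MatrixDescartes`) re-indexed
  over `Fin (K+1) = {0} ∪ succ(Fin K)`; nearest published statement: Cameron–Psarrakos,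
  doi:10.7153/oam-2019-13-48, Lemma 6 (`α(P) = 1 ⇒ z₊(P) ≤ n`, definite head) — here the head may
  be indefinite.
* `psdSector_derived_card_posRoots_eq_zero` : in this sector the DERIVED pencil `∂F` has all its
  coefficients positive semidefinite, hence NO positive root at all: the Rolle term of the crux is
  idle on the sector (`C` multiplies `0`), so the sector is a pure bound — consistent with the
  strategist's census F1/D6 (the derived tower never carries information on definite classes).
* `psdSector` : the crux inequality itself on the sector, for every `C` and every `A ≥ 1`
  (`m ≤ 2^(log₂ m + 1) ≤ 2^((log₂ m + 2)^A) ≤ budget`).  Offered to the crux chain as the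
  registered-stub shape `stub_psdSector`.
* `psdSector_top_card_posRoots_le` / `psdSector_top` : the mirror sector (top coefficient
  `S (Fin.last K)` arbitrary symmetric, all lower coefficients positive semidefinite), by the
  reflection `X ↦ 1/X` (`firstRung_high`).

No new definitions; Mathlib + tree only; axioms `propext`, `Classical.choice`, `Quot.sound`.
-/

-- single-conjunct layout: Sub = Summit, duplicated namespace component intended
set_option linter.dupNamespace false

namespace Summit.ValiantsHypothesis.ValiantsHypothesis.Theorems.SymmetroidDescartes

open Polynomial Matrix Finset
open scoped BigOperators

namespace DerivedPencilRolleQuasiPsdSector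

/-- Evaluating the determinant of a lacunary pencil `∑ₖ X^{a k} • Q k` at a real point `s` gives
the determinant of the real matrix `∑ₖ s^{a k} • Q k`. -/
theorem eval_det_pencil {ι κ : Type*} [Fintype ι] [DecidableEq ι] [Fintype κ] (a : κ → ℕ)
    (Q : κ → Matrix ι ι ℝ) (s : ℝ) :
    ((∑ k, (X : ℝ[X]) ^ a k • (Q k).map C).det).eval s = (∑ k, s ^ a k • Q k).det := by
  have h := RingHom.map_det (Polynomial.evalRingHom s) (∑ k, (X : ℝ[X]) ^ a k • (Q k).map C)
  rw [Polynomial.coe_evalRingHom] at h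
  rw [h]
  congr 1
  ext i j
  simp only [RingHom.mapMatrix_apply, Matrix.map_apply, Matrix.sum_apply, Matrix.smul_apply,
    smul_eq_mul, Polynomial.coe_evalRingHom, Polynomial.eval_finsetSum, Polynomial.eval_mul,
    Polynomial.eval_pow, Polynomial.eval_X, Polynomial.eval_C]

/-- **A pencil with positive semidefinite coefficients has no positive root.**  If every `Q k` is
positive semidefinite, the determinant of `∑ₖ X^{a k} • Q k` has no positive real root (Mathlib
convention: the zero polynomial has no roots either).  Indeed at a positive root `t` some `v ≠ 0`
has `∑ₖ t^{a k} Q k v = 0`; pairing with `v`, every `v ⬝ᵥ Q k v` vanishes, so `Q k v = 0` for all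
`k`, the kernel vector is common to all `∑ₖ s^{a k} Q k`, and the determinant vanishes identically. -/
theorem card_posRoots_eq_zero_of_posSemidef {ι κ : Type*} [Fintype ι] [DecidableEq ι] [Fintype κ]
    (a : κ → ℕ) (Q : κ → Matrix ι ι ℝ) (hQ : ∀ k, (Q k).PosSemidef) :
    (((∑ k, (X : ℝ[X]) ^ a k • (Q k).map C).det).roots.toFinset.filter (fun t => 0 < t)).card
      = 0 := by
  rw [Finset.card_eq_zero, Finset.filter_eq_empty_iff]
  intro t ht ht0
  rw [Multiset.mem_toFinset, Polynomial.mem_roots'] at ht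
  obtain ⟨hp, hroot⟩ := ht
  -- a kernel vector at the root
  have hdet0 : (∑ k, t ^ a k • Q k).det = 0 := by
    have h1 : ((∑ k, (X : ℝ[X]) ^ a k • (Q k).map C).det).eval t = 0 := hroot
    rwa [eval_det_pencil a Q t] at h1
  obtain ⟨v, hv, hGv⟩ := Matrix.exists_mulVec_eq_zero_iff.2 hdet0
  -- every quadratic form `v ⬝ᵥ Q k v` vanishes
  have hq : ∀ k, 0 ≤ v ⬝ᵥ (Q k *ᵥ v) := fun k => by
    simpa only [star_trivial] using (hQ k).dotProduct_mulVec_nonneg v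
  have hsum : ∑ k, t ^ a k * (v ⬝ᵥ (Q k *ᵥ v)) = 0 := by
    have h : v ⬝ᵥ ((∑ k, t ^ a k • Q k) *ᵥ v) = 0 := by rw [hGv, dotProduct_zero]
    rw [Matrix.sum_mulVec, dotProduct_sum] at h
    simpa only [Matrix.smul_mulVec, dotProduct_smul, smul_eq_mul] using h
  have hterm : ∀ k, 0 ≤ t ^ a k * (v ⬝ᵥ (Q k *ᵥ v)) := fun k =>
    mul_nonneg (pow_nonneg ht0.le _) (hq k)
  rw [Finset.sum_eq_zero_iff_of_nonneg (fun k _ => hterm k)] at hsum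
  have hQv : ∀ k, Q k *ᵥ v = 0 := fun k => by
    have hk : v ⬝ᵥ (Q k *ᵥ v) = 0 :=
      (mul_eq_zero.1 (hsum k (Finset.mem_univ k))).resolve_left (pow_ne_zero _ ht0.ne')
    have h := (hQ k).dotProduct_mulVec_zero_iff v
    rw [star_trivial] at h
    exact h.1 hk
  -- hence `v` is a kernel vector of `∑ₖ s^{a k} Q k` for every `s`, and the determinant is `0`
  have hdet' : ∀ s : ℝ, (∑ k, s ^ a k • Q k).det = 0 := fun s =>
    Matrix.exists_mulVec_eq_zero_iff.1 ⟨v, hv, by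
      rw [Matrix.sum_mulVec]
      exact Finset.sum_eq_zero fun k _ => by rw [Matrix.smul_mulVec, hQv k, smul_zero]⟩
  exact hp (Polynomial.funext fun s => by rw [eval_det_pencil a Q s, hdet' s, Polynomial.eval_zero])

/-- Budget arithmetic: `m ≤ 2 ^ (log₂ m + 2) ^ A` for `A ≥ 1`. -/
theorem le_two_pow_log_add_two_pow (m A : ℕ) (hA : 1 ≤ A) : m ≤ 2 ^ (Nat.log 2 m + 2) ^ A := by
  have h1 : m < 2 ^ (Nat.log 2 m + 1) := Nat.lt_pow_succ_log_self (by norm_num) m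
  have h2 : Nat.log 2 m + 1 ≤ (Nat.log 2 m + 2) ^ A := by
    calc Nat.log 2 m + 1 ≤ Nat.log 2 m + 2 := by omega
      _ = (Nat.log 2 m + 2) ^ 1 := (pow_one _).symm
      _ ≤ (Nat.log 2 m + 2) ^ A := Nat.pow_le_pow_right (by omega) hA
  exact h1.le.trans (Nat.pow_le_pow_right (by norm_num) h2)

/-- Budget arithmetic: `m ≤ C · Z + (K+1)^(A·K) · 2^((log₂ m + 2)^A)` for `A ≥ 1` and any `Z`. -/
theorem le_quasiBudget (m K C A Z : ℕ) (hA : 1 ≤ A) :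
    m ≤ C * Z + (K + 1) ^ (A * K) * 2 ^ (Nat.log 2 m + 2) ^ A := by
  have h1 := le_two_pow_log_add_two_pow m A hA
  have h2 : 1 ≤ (K + 1) ^ (A * K) := Nat.one_le_pow _ _ (Nat.succ_pos K)
  calc m ≤ 2 ^ (Nat.log 2 m + 2) ^ A := h1
    _ = 1 * 2 ^ (Nat.log 2 m + 2) ^ A := (one_mul _).symm
    _ ≤ (K + 1) ^ (A * K) * 2 ^ (Nat.log 2 m + 2) ^ A := Nat.mul_le_mul_right _ h2
    _ ≤ C * Z + (K + 1) ^ (A * K) * 2 ^ (Nat.log 2 m + 2) ^ A := Nat.le_add_left _ _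

end DerivedPencilRolleQuasiPsdSector

open DerivedPencilRolleQuasiPsdSector

/-- **PSD sector, sharp form.**  For a `(K+1)`-term lacunary pencil `∑ₗ X^{d l} • S l` of real
`m × m` matrices whose head `S 0` is symmetric, whose tail `S 1, …, S K` is positive semidefinite
and whose head exponent is minimal (`d 0 ≤ d l`), the determinant has at most `m` distinct positive
real roots.  (Re-indexing of `LacunarySymmetroidMatrixDescartes.firstRung_low`: the family
`t^{-d 0} F(t)` is Loewner non-decreasing on `(0,∞)`; cf. Cameron–Psarrakos 2019, Lemma 6.) -/
theorem psdSector_card_posRoots_le (m K : ℕ) (S : Fin (K + 1) → Matrix (Fin m) (Fin m) ℝ)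
    (d : Fin (K + 1) → ℕ) (h0 : (S 0).IsSymm) (hpsd : ∀ l : Fin K, (S l.succ).PosSemidef)
    (hd : ∀ l, d 0 ≤ d l) :
    ((∑ l, (Polynomial.X : Polynomial ℝ) ^ d l • (S l).map Polynomial.C).det.roots.toFinset.filter
        (fun t => 0 < t)).card ≤ m := by
  have h := LacunarySymmetroidMatrixDescartes.firstRung_low (Fin m) (Fin K) (d 0)
    (fun l => d l.succ) (S 0) (fun l => S l.succ) h0 hpsd (fun l => hd l.succ)
  rw [Fintype.card_fin] at h
  simpa only [Fin.sum_univ_succ] using h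

/-- **PSD sector: the derived pencil is root-free.**  If the tail `S 1, …, S K` is positive
semidefinite, the crux's derived pencil `∂F = ∑_{l<K} X^{d (l+1) − d 0 − 1} • ((d (l+1) − d 0) • S (l+1))`
has positive semidefinite coefficients, hence its determinant has NO positive real root: on this
sector the Rolle term `C · Z₊(det ∂F)` of the crux vanishes identically. -/
theorem psdSector_derived_card_posRoots_eq_zero (m K : ℕ)
    (S : Fin (K + 1) → Matrix (Fin m) (Fin m) ℝ) (d : Fin (K + 1) → ℕ)
    (hpsd : ∀ l : Fin K, (S l.succ).PosSemidef) :
    ((∑ l : Fin K, (Polynomial.X : Polynomial ℝ) ^ (d l.succ - d 0 - 1) •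
        (((d l.succ - d 0 : ℕ) : ℝ) • S l.succ).map Polynomial.C).det.roots.toFinset.filter
          (fun t => 0 < t)).card = 0 :=
  card_posRoots_eq_zero_of_posSemidef (fun l : Fin K => d l.succ - d 0 - 1)
    (fun l => ((d l.succ - d 0 : ℕ) : ℝ) • S l.succ) fun l => (hpsd l).smul (Nat.cast_nonneg _)

/-- **PSD sector of the crux `DerivedPencilRolleQuasi` (the shape `stub_psdSector`).**  For EVERY
`C` and every `A ≥ 1`, the crux inequality
`Z₊(det F) ≤ C · Z₊(det ∂F) + (K+1)^(A·K) · 2^((log₂ m + 2)^A)` holds for all `(K+1)`-term lacunary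
pencils with real symmetric invertible coefficients and strictly increasing exponents whose tail
`S 1, …, S K` is positive semidefinite: indeed `Z₊(det F) ≤ m ≤ 2^(log₂ m + 1)` by
`psdSector_card_posRoots_le` (and `Z₊(det ∂F) = 0` by `psdSector_derived_card_posRoots_eq_zero`,
which is not even needed).  The hypotheses `hS`/`hdet` beyond `S 0` symmetric are those of the
crux and are kept verbatim. -/
theorem psdSector (C A : ℕ) (hA : 1 ≤ A) (m K : ℕ) (S : Fin (K + 1) → Matrix (Fin m) (Fin m) ℝ)
    (d : Fin (K + 1) → ℕ) (hS : ∀ l, (S l).IsSymm) (_hdet : ∀ l, (S l).det ≠ 0)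
    (hd : StrictMono d) (hpsd : ∀ l : Fin K, (S l.succ).PosSemidef) :
    ((∑ l, (Polynomial.X : Polynomial ℝ) ^ d l • (S l).map Polynomial.C).det.roots.toFinset.filter
        (fun t => 0 < t)).card
      ≤ C * ((∑ l : Fin K, (Polynomial.X : Polynomial ℝ) ^ (d l.succ - d 0 - 1) •
          (((d l.succ - d 0 : ℕ) : ℝ) • S l.succ).map Polynomial.C).det.roots.toFinset.filter
            (fun t => 0 < t)).card
        + (K + 1) ^ (A * K) * 2 ^ (Nat.log 2 m + 2) ^ A :=
  (psdSector_card_posRoots_le m K S d (hS 0) hpsd fun l => hd.monotone (Fin.zero_le l)).trans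
    (le_quasiBudget m K C A _ hA)

/-- **Registered stub shape `stub_psdSector`** (crux stmt-ValiantsHypothesis-18064, PSD sector, as a
closed `Prop`): for every `C` and every `A ≥ 1` the crux inequality of `DerivedPencilRolleQuasi`
holds on the pencils whose lacunary tail `S 1, …, S K` is positive semidefinite.  This is
`psdSector` with its binders discharged; a sector-split skeleton may cite it by name. -/
theorem stub_psdSector : ∀ (C A : ℕ), 1 ≤ A → ∀ (m K : ℕ) (S : Fin (K + 1) → Matrix (Fin m) (Fin m) ℝ) (d : Fin (K + 1) → ℕ), (∀ l, (S l).IsSymm) → (∀ l, (S l).det ≠ 0) → StrictMono d → (∀ l : Fin K, (S l.succ).PosSemidef) → ((∑ l, (Polynomial.X : Polynomial ℝ) ^ d l • (S l).map Polynomial.C).det.roots.toFinset.filter (fun t => 0 < t)).card ≤ C * ((∑ l : Fin K, (Polynomial.X : Polynomial ℝ) ^ (d l.succ - d 0 - 1) • (((d l.succ - d 0 : ℕ) : ℝ) • S l.succ).map Polynomial.C).det.roots.toFinset.filter (fun t => 0 < t)).card + (K + 1) ^ (A * K) * 2 ^ (Nat.log 2 m + 2) ^ A :=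
  fun C A hA m K S d hS hdet hd hpsd => psdSector C A hA m K S d hS hdet hd hpsd

/-- **Mirror PSD sector, sharp form.**  If the TOP coefficient `S (Fin.last K)` is symmetric, all
lower coefficients are positive semidefinite and the top exponent is maximal (`d l ≤ d (Fin.last K)`),
the determinant of `∑ₗ X^{d l} • S l` has at most `m` distinct positive real roots (reflection
`X ↦ 1/X`; `LacunarySymmetroidMatrixDescartes.firstRung_high`). -/
theorem psdSector_top_card_posRoots_le (m K : ℕ) (S : Fin (K + 1) → Matrix (Fin m) (Fin m) ℝ)
    (d : Fin (K + 1) → ℕ) (hK : (S (Fin.last K)).IsSymm)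
    (hpsd : ∀ l : Fin K, (S l.castSucc).PosSemidef) (hd : ∀ l, d l ≤ d (Fin.last K)) :
    ((∑ l, (Polynomial.X : Polynomial ℝ) ^ d l • (S l).map Polynomial.C).det.roots.toFinset.filter
        (fun t => 0 < t)).card ≤ m := by
  have h := LacunarySymmetroidMatrixDescartes.firstRung_high (Fin m) (Fin K) (d (Fin.last K))
    (fun l => d l.castSucc) (S (Fin.last K)) (fun l => S l.castSucc) hK hpsd (fun l => hd l.castSucc)
  rw [Fintype.card_fin] at h
  simpa only [Fin.sum_univ_castSucc, add_comm] using h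

/-- **Mirror PSD sector of the crux.**  For every `C` and every `A ≥ 1` the crux inequality holds
for all `(K+1)`-term lacunary pencils with real symmetric invertible coefficients and strictly
increasing exponents whose coefficients BELOW the top one are positive semidefinite (the top
coefficient `S (Fin.last K)` is an arbitrary symmetric invertible matrix). -/
theorem psdSector_top (C A : ℕ) (hA : 1 ≤ A) (m K : ℕ) (S : Fin (K + 1) → Matrix (Fin m) (Fin m) ℝ)
    (d : Fin (K + 1) → ℕ) (hS : ∀ l, (S l).IsSymm) (_hdet : ∀ l, (S l).det ≠ 0)
    (hd : StrictMono d) (hpsd : ∀ l : Fin K, (S l.castSucc).PosSemidef) :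
    ((∑ l, (Polynomial.X : Polynomial ℝ) ^ d l • (S l).map Polynomial.C).det.roots.toFinset.filter
        (fun t => 0 < t)).card
      ≤ C * ((∑ l : Fin K, (Polynomial.X : Polynomial ℝ) ^ (d l.succ - d 0 - 1) •
          (((d l.succ - d 0 : ℕ) : ℝ) • S l.succ).map Polynomial.C).det.roots.toFinset.filter
            (fun t => 0 < t)).card
        + (K + 1) ^ (A * K) * 2 ^ (Nat.log 2 m + 2) ^ A :=
  (psdSector_top_card_posRoots_le m K S d (hS (Fin.last K)) hpsd
      fun l => hd.monotone (Fin.le_last l)).trans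
    (le_quasiBudget m K C A _ hA)

end Summit.ValiantsHypothesis.ValiantsHypothesis.Theorems.SymmetroidDescartes
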